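import Mathlib
import Summits.AtomisticToContinuum.Crystallization.Theorems.NashClassCertificatesNashNearFieldStubCauchyBornBarlowCoercivity

/-!
# Crux `NashNearField` (stmt-AtomisticToContinuum-16827), line `birth`, stub `stub_cauchyBornBarlowCoercivity` (CBBC):
# deformed layer sums (infrastructure for the word-free reduction)

CBBC (skeleton v6, `r ≤ 1/10`): `∃ κ > 0` such that for every periodic Hägg word `s`, every continuous linear
automorphism `G` of `ℝ³` in the `4/5–6/5` tube and every `0 ≤ r ≤ 1/10`, if `G` is `r`-far on the unit-template sites
of norm `≤ 3` from every box-scaled isometric template `A p_{a,h}`, then `e* + κ r² ≤ e(G · unit stacking of s)`.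
The companion file `…StubCauchyBornBarlowCoercivity` reduced CBBC to the lattice-sum landscape inequality; the file
`…StubCauchyBornBarlowCoercivityWordFree` removes the word from the remaining numerics.  This file carries the layer
bookkeeping of the DEFORMED stacking that the word-free bound consumes:

* `cbbc_layerVec_add_three_mul`, `cbbc_barlowPos_eq_layerVec`, `cbbc_barlowPos_zero_seq_add`, `cbbc_dist_deformed_eq` —
  vector identities (`3w = u + v`; template sites are layer vectors; deformed distances are norms of deformed layer
  vectors `‖G (layerVec (L k − L n) (k − n) i j)‖`);
* `cbbc_summable_lennardJones_deformed` — summability of `q ↦ V_LJ(dist x (G x_q))` over the `ℤ³` parametrisation of a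
  Barlow stacking (the deformed stacking is the point set of `(barlowPeriodicConfiguration s).linearImage G`);
  `cbbc_summable_deformedLayer` (`_above`, `_below`) — the deformed layer sums
  `I(δ, t) = ∑'_{(i,j)} V_LJ ‖G (layerVec a h δ t i j)‖` are summable over the signed layer distance;
  `cbbc_summable_layerInteraction_int` — so are the reference layer interactions along any offset sequence;
* `cbbc_tsum_deformed_eq_layers` — **the deformed site sum layer by layer**:
  `∑'_q V(dist (G x_n) (G x_q)) = ∑_{k≥0} I(L(n+k+1) − L n, k+1) + I(0, 0) + ∑_{k≥0} I(L(n−k−1) − L n, −(k+1))`;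
  `cbbc_barlowSiteEnergy_eq_layers` — the same for the reference `barlowSiteEnergy V_LJ a h s n`
  (`cbbc_inLayerInteraction_eq`: the punctured in-layer sum is `layerInteraction V_LJ a h 0 0` since `V_LJ 0 = 0`);
* `cbbc_deformedLayer_add_three_mul` — `I(δ + 3q, t) = I(δ, t)`; `cbbc_min_three_le`, `cbbc_min_two_le` — a `3`-periodic
  function of the offset is at least the minimum of its values at `0, 1, −1` (at `1, −1` off the aligned class).
-/

noncomputable section

open scoped BigOperators
open Literature.MathematicalPhysics.StatisticalMechanics Literature.Geometry.DiscreteGeometry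

namespace Summit.AtomisticToContinuum.Crystallization.Theorems.NashClassCertificatesNashNearField

open Summit.AtomisticToContinuum.Crystallization.Theorems
  (barlowPos_injective haggLabel_zero_seq summable_layerInteraction_lennardJones)

/-! ## Vector identities for the layer vectors -/

/-- `3 w = u + v`: shifting the offset by `3q` letters is the reindexing `(i, j) ↦ (i + q, j + q)` (as vectors).
[folklore] -/
theorem cbbc_layerVec_add_three_mul (a h : ℝ) (δ q k i j : ℤ) :
    layerVec a h (δ + 3 * q) k i j = layerVec a h δ k (i + q) (j + q) := by
  ext l
  fin_cases l <;> simp [layerVec, triangularVec₁, triangularVec₂, barlowOffset, layerNormal] <;> ring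

/-- The in-layer vector `layerVec a h 0 0 0 0` is the origin. [folklore] -/
theorem cbbc_layerVec_zero (a h : ℝ) : layerVec a h 0 0 0 0 = 0 := by
  simp [layerVec]

/-- Template sites are layer vectors: `barlowPos a h s m u v = layerVec a h (L m) m u v`. [folklore] -/
theorem cbbc_barlowPos_eq_layerVec (a h : ℝ) (s : ℤ → ℤ) (m u v : ℤ) :
    barlowPos a h s m u v = layerVec a h (haggLabel s m) m u v := rfl

/-- The points of the Bravais stacking of the zero sequence, shifted by `δ w`, are the layer vectors of offset `δ`.
[folklore] -/
theorem cbbc_barlowPos_zero_seq_add (a h : ℝ) (δ k i j : ℤ) :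
    barlowPos a h (fun _ : ℤ => (0 : ℤ)) k i j + (δ : ℝ) • barlowOffset a = layerVec a h δ k i j := by
  simp only [barlowPos, layerVec, haggLabel_zero_seq, Int.cast_zero, zero_smul, add_zero]
  module

/-- Deformed distances between stacking points are norms of deformed layer vectors:
`dist (G x_n) (G x_{k,i,j}) = ‖G (layerVec (L k − L n) (k − n) i j)‖` (`x_n = barlowPos n 0 0`). [folklore] -/
theorem cbbc_dist_deformed_eq {F : Type*} [FunLike F (EuclideanSpace ℝ (Fin 3)) (EuclideanSpace ℝ (Fin 3))]
    [AddMonoidHomClass F (EuclideanSpace ℝ (Fin 3)) (EuclideanSpace ℝ (Fin 3))] (a h : ℝ) (s : ℤ → ℤ)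
    (G : F) (n k i j : ℤ) :
    dist (G (barlowPos a h s n 0 0)) (G (barlowPos a h s k i j)) =
      ‖G (layerVec a h (haggLabel s k - haggLabel s n) (k - n) i j)‖ := by
  rw [dist_comm, dist_eq_norm, ← map_sub, barlowPos_sub_barlowPos, sub_zero, sub_zero]

/-! ## Summability of the deformed lattice sums -/

section Summability

variable {a h : ℝ} {s : ℤ → ℤ} {p : ℕ}

/-- **Summability of the Lennard-Jones sum over a homogeneously deformed Barlow stacking, in the `ℤ³`
parametrisation.**  For `a, h > 0`, a `p`-periodic `s`, a continuous linear automorphism `G` and any point `x`,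
`q ↦ V_LJ (dist x (G (barlowPos a h s q)))` is summable (the deformed stacking is the point set of the periodic
configuration `(barlowPeriodicConfiguration s).linearImage G`). [folklore] -/
theorem cbbc_summable_lennardJones_deformed (ha : 0 < a) (hh : 0 < h) (ha' : a ≠ 0) (hh' : h ≠ 0)
    (hp : p ≠ 0) (hs : ∀ i, s (i + p) = s i)
    (G : EuclideanSpace ℝ (Fin 3) ≃L[ℝ] EuclideanSpace ℝ (Fin 3)) (x : EuclideanSpace ℝ (Fin 3)) :
    Summable fun q : ℤ × ℤ × ℤ => lennardJones (dist x (G (barlowPos a h s q.1 q.2.1 q.2.2))) := by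
  -- adapted from `summable_lennardJones_barlowPos` (MinMeanCycleStackingLockBarlowEnergyIdentification)
  set P := (barlowPeriodicConfiguration s ha' hh' hp hs).linearImage G with hPdef
  have hP : P.points = G '' barlowStacking a h s := by
    rw [hPdef, PeriodicConfiguration.points_linearImage, barlowPeriodicConfiguration_points]
  have hF := P.summable_lennardJones_dist_three x
  set g : ℤ × ℤ × ℤ → EuclideanSpace ℝ (Fin 3) := fun q => G (barlowPos a h s q.1 q.2.1 q.2.2)
    with hgdef
  have hg : Function.Injective g := G.injective.comp (barlowPos_injective ha hh s)
  have hS : (g ⁻¹' {x}).Finite := (Set.subsingleton_singleton.preimage hg).finite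
  have hmem : ∀ q, g q ∈ P.points := fun q => by
    rw [hP]
    exact ⟨_, barlowPos_mem _ _ _, rfl⟩
  let φ : ↥(g ⁻¹' {x})ᶜ → {y // y ∈ P.points ∧ y ≠ x} :=
    fun c => ⟨g c.1, hmem c.1, fun hc => c.2 hc⟩
  have hφ : Function.Injective φ := by
    intro c c' hcc'
    have h1 : g c.1 = g c'.1 := congrArg Subtype.val hcc'
    exact Subtype.ext (hg h1)
  have h1 : Summable ((fun y : {y // y ∈ P.points ∧ y ≠ x} => lennardJones (dist x y.1)) ∘ φ) :=
    hF.comp_injective hφ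
  have h2 : Summable ((fun q : ℤ × ℤ × ℤ => lennardJones (dist x (g q))) ∘
      ((↑) : ↥(g ⁻¹' {x})ᶜ → ℤ × ℤ × ℤ)) := h1
  exact hS.summable_compl_iff.1 h2

/-- **The deformed layer sums of a Bravais layer family are summable over the layer distance**: for every offset
`δ`, `t ↦ ∑'_{(i,j)} V_LJ ‖G (layerVec a h δ t i j)‖` is summable over `t : ℤ` (the full sum is the Lennard-Jones sum
of the deformed Bravais lattice `G(ℤu + ℤv + ℤh e₃)` seen from `G(−δ w)`). [folklore] -/
theorem cbbc_summable_deformedLayer (ha : 0 < a) (hh : 0 < h)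
    (G : EuclideanSpace ℝ (Fin 3) ≃L[ℝ] EuclideanSpace ℝ (Fin 3)) (δ : ℤ) :
    Summable fun t : ℤ => ∑' ij : ℤ × ℤ, lennardJones ‖G (layerVec a h δ t ij.1 ij.2)‖ := by
  have hs : ∀ i : ℤ, (fun _ : ℤ => (0 : ℤ)) (i + (1 : ℕ)) = (fun _ : ℤ => (0 : ℤ)) i := fun _ => rfl
  have hF := cbbc_summable_lennardJones_deformed (s := fun _ : ℤ => (0 : ℤ)) (p := 1) ha hh ha.ne'
    hh.ne' one_ne_zero hs G (G (-((δ : ℝ) • barlowOffset a)))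
  refine hF.prod.congr fun t => tsum_congr fun ij => ?_
  congr 1
  rw [dist_eq_norm, ← map_sub, ← norm_neg, ← map_neg, neg_sub, sub_neg_eq_add,
    cbbc_barlowPos_zero_seq_add]

/-- The same over the layers above (`t = k + 1`, `k : ℕ`). [folklore] -/
theorem cbbc_summable_deformedLayer_above (ha : 0 < a) (hh : 0 < h)
    (G : EuclideanSpace ℝ (Fin 3) ≃L[ℝ] EuclideanSpace ℝ (Fin 3)) (δ : ℤ) :
    Summable fun k : ℕ => ∑' ij : ℤ × ℤ, lennardJones ‖G (layerVec a h δ ((k : ℤ) + 1) ij.1 ij.2)‖ :=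
  (cbbc_summable_deformedLayer ha hh G δ).comp_injective (i := fun k : ℕ => (k : ℤ) + 1)
    fun k k' (hk : (k : ℤ) + 1 = (k' : ℤ) + 1) => by omega

/-- The same over the layers below (`t = −(k + 1)`, `k : ℕ`). [folklore] -/
theorem cbbc_summable_deformedLayer_below (ha : 0 < a) (hh : 0 < h)
    (G : EuclideanSpace ℝ (Fin 3) ≃L[ℝ] EuclideanSpace ℝ (Fin 3)) (δ : ℤ) :
    Summable fun k : ℕ => ∑' ij : ℤ × ℤ, lennardJones ‖G (layerVec a h δ (-((k : ℤ) + 1)) ij.1 ij.2)‖ :=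
  (cbbc_summable_deformedLayer ha hh G δ).comp_injective (i := fun k : ℕ => -((k : ℤ) + 1))
    fun k k' (hk : -((k : ℤ) + 1) = -((k' : ℤ) + 1)) => by omega

/-- The aligned / non-aligned Lennard-Jones layer interactions are summable over the signed layer distance as well
(`layerInteraction` is even in the layer distance and `3`-periodic and even in the offset). [folklore] -/
theorem cbbc_summable_layerInteraction_int (ha : 0 < a) (hh : 0 < h) (t : ℕ → ℤ) (ht : ∀ k, t k = (k : ℤ) + 1 ∨ t k = -((k : ℤ) + 1)) (d : ℕ → ℤ) :
    Summable fun k : ℕ => layerInteraction lennardJones a h (d k) (t k) := by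
  have hA := (summable_nat_add_iff (f := fun k : ℕ => layerInteraction lennardJones a h 0 k) 1).2
    (summable_layerInteraction_lennardJones ha hh 0)
  have hN := (summable_nat_add_iff (f := fun k : ℕ => layerInteraction lennardJones a h 1 k) 1).2
    (summable_layerInteraction_lennardJones ha hh 1)
  refine Summable.of_norm_bounded (g := fun k : ℕ => |layerInteraction lennardJones a h 0 ((k + 1 : ℕ) : ℤ)| + |layerInteraction lennardJones a h 1 ((k + 1 : ℕ) : ℤ)|) (hA.abs.add hN.abs) fun k => ?_
  rw [Real.norm_eq_abs]
  have hk : layerInteraction lennardJones a h (d k) (t k) = layerInteraction lennardJones a h (d k) ((k + 1 : ℕ) : ℤ) := by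
    rcases ht k with h1 | h1
    · rw [h1]; push_cast; rfl
    · rw [h1, show -((k : ℤ) + 1) = -(((k + 1 : ℕ) : ℤ)) by push_cast; ring, layerInteraction_neg_layer]
  rw [hk, layerInteraction_eq_ite]
  split_ifs
  · exact le_add_of_nonneg_right (abs_nonneg _)
  · exact le_add_of_nonneg_left (abs_nonneg _)

end Summability


/-! ## The deformed site sum, layer by layer -/

section Layers

variable {a₁ h₁ a h : ℝ} {s : ℤ → ℤ} {p : ℕ}

/-- Summability of the layer terms of the deformed site sum over the signed layer distance (recentred at the base
layer `n`). [folklore] -/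
theorem cbbc_summable_deformed_layers (ha₁ : 0 < a₁) (hh₁ : 0 < h₁) (hp : p ≠ 0) (hs : ∀ i, s (i + p) = s i)
    (G : EuclideanSpace ℝ (Fin 3) ≃L[ℝ] EuclideanSpace ℝ (Fin 3)) (n : ℤ) :
    Summable fun t : ℤ => ∑' ij : ℤ × ℤ,
      lennardJones ‖G (layerVec a₁ h₁ (haggLabel s (n + t) - haggLabel s n) t ij.1 ij.2)‖ := by
  have hF := cbbc_summable_lennardJones_deformed ha₁ hh₁ ha₁.ne' hh₁.ne' hp hs G (G (barlowPos a₁ h₁ s n 0 0))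
  have hG : Summable fun k : ℤ => ∑' ij : ℤ × ℤ,
      lennardJones ‖G (layerVec a₁ h₁ (haggLabel s k - haggLabel s n) (k - n) ij.1 ij.2)‖ :=
    hF.prod.congr fun k => tsum_congr fun ij => by rw [cbbc_dist_deformed_eq]
  have hG' := hG.comp_injective (Equiv.addLeft n).injective
  refine hG'.congr fun t => ?_
  simp only [Function.comp_apply, Equiv.coe_addLeft, add_sub_cancel_left]

/-- **The deformed Lennard-Jones site sum of a Barlow stacking, layer by layer**: for the site `x_n = barlowPos n 0 0`
of the word `s` (template spacings `a₁, h₁ > 0`) and a continuous linear automorphism `G`,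
`∑'_{q ∈ ℤ³} V(dist (G x_n) (G x_q)) = ∑'_{k ≥ 0} I(L(n+k+1) − L n, k+1) + I(0, 0) + ∑'_{k ≥ 0} I(L(n−k−1) − L n, −(k+1))`
with the deformed layer sums `I(δ, t) = ∑'_{(i,j)} V ‖G (layerVec a₁ h₁ δ t i j)‖` (the `(i,j) = 0` term of `I(0,0)` is
`V 0 = 0`). [folklore] -/
theorem cbbc_tsum_deformed_eq_layers (ha₁ : 0 < a₁) (hh₁ : 0 < h₁) (hp : p ≠ 0) (hs : ∀ i, s (i + p) = s i)
    (G : EuclideanSpace ℝ (Fin 3) ≃L[ℝ] EuclideanSpace ℝ (Fin 3)) (n : ℤ) :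
    ∑' q : ℤ × ℤ × ℤ, lennardJones (dist (G (barlowPos a₁ h₁ s n 0 0)) (G (barlowPos a₁ h₁ s q.1 q.2.1 q.2.2))) =
      (∑' k : ℕ, ∑' ij : ℤ × ℤ, lennardJones
        ‖G (layerVec a₁ h₁ (haggLabel s (n + ((k : ℤ) + 1)) - haggLabel s n) ((k : ℤ) + 1) ij.1 ij.2)‖) +
      (∑' ij : ℤ × ℤ, lennardJones ‖G (layerVec a₁ h₁ 0 0 ij.1 ij.2)‖) +
      ∑' k : ℕ, ∑' ij : ℤ × ℤ, lennardJones
        ‖G (layerVec a₁ h₁ (haggLabel s (n + -((k : ℤ) + 1)) - haggLabel s n) (-((k : ℤ) + 1)) ij.1 ij.2)‖ := by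
  have hF := cbbc_summable_lennardJones_deformed ha₁ hh₁ ha₁.ne' hh₁.ne' hp hs G (G (barlowPos a₁ h₁ s n 0 0))
  -- layer by layer, then recentre at `n`
  have e2 : ∑' q : ℤ × ℤ × ℤ,
      lennardJones (dist (G (barlowPos a₁ h₁ s n 0 0)) (G (barlowPos a₁ h₁ s q.1 q.2.1 q.2.2))) =
      ∑' k : ℤ, ∑' ij : ℤ × ℤ,
        lennardJones ‖G (layerVec a₁ h₁ (haggLabel s k - haggLabel s n) (k - n) ij.1 ij.2)‖ :=
    hF.tsum_prod.trans (tsum_congr fun k => tsum_congr fun ij => by rw [cbbc_dist_deformed_eq])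
  set f : ℤ → ℝ := fun t => ∑' ij : ℤ × ℤ,
    lennardJones ‖G (layerVec a₁ h₁ (haggLabel s (n + t) - haggLabel s n) t ij.1 ij.2)‖ with hfdef
  have e1 : ∑' k : ℤ, ∑' ij : ℤ × ℤ,
        lennardJones ‖G (layerVec a₁ h₁ (haggLabel s k - haggLabel s n) (k - n) ij.1 ij.2)‖ = ∑' t : ℤ, f t := by
    rw [← (Equiv.addLeft n).tsum_eq]
    refine tsum_congr fun t => ?_
    simp only [hfdef, Equiv.coe_addLeft, add_sub_cancel_left]
  have hf : Summable f := cbbc_summable_deformed_layers ha₁ hh₁ hp hs G n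
  have h1 : Summable fun k : ℕ => f ((k : ℤ) + 1) :=
    hf.comp_injective (i := fun k : ℕ => (k : ℤ) + 1) fun k k' (hk : (k : ℤ) + 1 = (k' : ℤ) + 1) => by omega
  have h2 : Summable fun k : ℕ => f (-((k : ℤ) + 1)) :=
    hf.comp_injective (i := fun k : ℕ => -((k : ℤ) + 1))
      fun k k' (hk : -((k : ℤ) + 1) = -((k' : ℤ) + 1)) => by omega
  rw [e2, e1, tsum_of_add_one_of_neg_add_one h1 h2]
  simp only [hfdef, add_zero, sub_self]

/-- For Lennard-Jones the punctured in-layer sum is the full in-layer layer interaction (`V_LJ 0 = 0`). [folklore] -/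
theorem cbbc_inLayerInteraction_eq (a h : ℝ) :
    inLayerInteraction lennardJones a = layerInteraction lennardJones a h 0 0 := by
  unfold inLayerInteraction layerInteraction
  refine tsum_congr fun ij => ?_
  split_ifs with hij
  · rw [hij, Prod.fst_zero, Prod.snd_zero, cbbc_layerVec_zero, norm_zero, lennardJones_zero]
  · rw [layerVec_zero_zero]

/-- **The reference site energy, layer by layer** (the same bookkeeping for `barlowSiteEnergy`):
`barlowSiteEnergy V_LJ a h s n = ½ (∑'_{k} Φ(L(n+k+1) − L n, k+1) + Φ(0,0) + ∑'_{k} Φ(L(n−k−1) − L n, −(k+1)))`,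
`Φ = layerInteraction V_LJ a h`. [folklore] -/
theorem cbbc_barlowSiteEnergy_eq_layers (a h : ℝ) (s : ℤ → ℤ) (n : ℤ) :
    barlowSiteEnergy lennardJones a h s n = (1 / 2 : ℝ) *
      ((∑' k : ℕ, layerInteraction lennardJones a h (haggLabel s (n + ((k : ℤ) + 1)) - haggLabel s n) ((k : ℤ) + 1)) +
        layerInteraction lennardJones a h 0 0 +
        ∑' k : ℕ, layerInteraction lennardJones a h (haggLabel s (n + -((k : ℤ) + 1)) - haggLabel s n)
          (-((k : ℤ) + 1))) := by
  unfold barlowSiteEnergy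
  rw [tsum_inLayer, cbbc_inLayerInteraction_eq a h]
  have eB : ∀ k : ℕ, ∑' ij : ℤ × ℤ, lennardJones
      (dist (barlowPos a h s n 0 0) (barlowPos a h s (n + (k + 1 : ℕ)) ij.1 ij.2)) =
      layerInteraction lennardJones a h (haggLabel s (n + ((k : ℤ) + 1)) - haggLabel s n) ((k : ℤ) + 1) := by
    intro k
    rw [tsum_layer, add_sub_cancel_left]
    push_cast
    rfl
  have eC : ∀ k : ℕ, ∑' ij : ℤ × ℤ, lennardJones
      (dist (barlowPos a h s n 0 0) (barlowPos a h s (n - (k + 1 : ℕ)) ij.1 ij.2)) =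
      layerInteraction lennardJones a h (haggLabel s (n + -((k : ℤ) + 1)) - haggLabel s n) (-((k : ℤ) + 1)) := by
    intro k
    rw [tsum_layer, sub_sub_cancel_left, sub_eq_add_neg]
    push_cast
    rfl
  rw [tsum_congr eB, tsum_congr eC]
  ring

/-- The deformed layer sums depend on the offset only modulo `3` (reindexing `(i, j) ↦ (i + q, j + q)`). [folklore] -/
theorem cbbc_deformedLayer_add_three_mul (V : ℝ → ℝ) (G : EuclideanSpace ℝ (Fin 3) → EuclideanSpace ℝ (Fin 3))
    (a₁ h₁ : ℝ) (δ q t : ℤ) :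
    ∑' ij : ℤ × ℤ, V ‖G (layerVec a₁ h₁ (δ + 3 * q) t ij.1 ij.2)‖ =
      ∑' ij : ℤ × ℤ, V ‖G (layerVec a₁ h₁ δ t ij.1 ij.2)‖ := by
  rw [← Equiv.tsum_eq (Equiv.addRight ((q, q) : ℤ × ℤ)) fun ij : ℤ × ℤ => V ‖G (layerVec a₁ h₁ δ t ij.1 ij.2)‖]
  refine tsum_congr fun ij => ?_
  rw [cbbc_layerVec_add_three_mul]
  rfl

/-- A `3`-periodic function of the offset is bounded below by the minimum of its values at `0, 1, −1`. [folklore] -/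
theorem cbbc_min_three_le {Δ : ℤ → ℝ} (hΔ : ∀ δ q : ℤ, Δ (δ + 3 * q) = Δ δ) (δ : ℤ) :
    min (Δ 0) (min (Δ 1) (Δ (-1))) ≤ Δ δ := by
  rcases (show δ % 3 = 0 ∨ δ % 3 = 1 ∨ δ % 3 = 2 by omega) with h0 | h1 | h2
  · rw [show δ = 0 + 3 * (δ / 3) by omega, hΔ]
    exact min_le_left _ _
  · rw [show δ = 1 + 3 * (δ / 3) by omega, hΔ]
    exact (min_le_right _ _).trans (min_le_left _ _)
  · rw [show δ = -1 + 3 * (δ / 3 + 1) by omega, hΔ]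
    exact (min_le_right _ _).trans (min_le_right _ _)

/-- A `3`-periodic function of the offset, at an offset `≢ 0 (mod 3)`, is bounded below by the minimum of its values at
`1, −1`. [folklore] -/
theorem cbbc_min_two_le {Δ : ℤ → ℝ} (hΔ : ∀ δ q : ℤ, Δ (δ + 3 * q) = Δ δ) (δ : ℤ) (hδ : δ % 3 ≠ 0) :
    min (Δ 1) (Δ (-1)) ≤ Δ δ := by
  rcases (show δ % 3 = 1 ∨ δ % 3 = 2 by omega) with h1 | h2
  · rw [show δ = 1 + 3 * (δ / 3) by omega, hΔ]
    exact min_le_left _ _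
  · rw [show δ = -1 + 3 * (δ / 3 + 1) by omega, hΔ]
    exact min_le_right _ _

/-- `|min x y| ≤ |x| + |y|`. [folklore] -/
theorem cbbc_abs_min_le (x y : ℝ) : |min x y| ≤ |x| + |y| := by
  rcases min_choice x y with h | h <;> rw [h] <;> linarith [abs_nonneg x, abs_nonneg y]

/-- `|min x (min y z)| ≤ |x| + |y| + |z|`. [folklore] -/
theorem cbbc_abs_min_three_le (x y z : ℝ) : |min x (min y z)| ≤ |x| + |y| + |z| := by
  have := cbbc_abs_min_le x (min y z)
  have := cbbc_abs_min_le y z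
  linarith


/-- **Stub piece `stub_deformedSiteSumLayers` (proved; registered form of the layer bookkeeping of the deformed
stacking)**: summability of the deformed `ℤ³` site sum and of the deformed layer sums, and the decomposition of the
deformed site sum layer by layer. [folklore] -/
theorem stub_deformedSiteSumLayers :
    ∀ (a₁ h₁ : ℝ) (s : ℤ → ℤ) (p : ℕ) (ha₁ : 0 < a₁) (hh₁ : 0 < h₁) (hp : p ≠ 0) (hs : ∀ i, s (i + p) = s i)
      (G : EuclideanSpace ℝ (Fin 3) ≃L[ℝ] EuclideanSpace ℝ (Fin 3)) (n : ℤ),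
      (Summable fun q : ℤ × ℤ × ℤ =>
        lennardJones (dist (G (barlowPos a₁ h₁ s n 0 0)) (G (barlowPos a₁ h₁ s q.1 q.2.1 q.2.2)))) ∧
      (∀ δ : ℤ, Summable fun t : ℤ => ∑' ij : ℤ × ℤ, lennardJones ‖G (layerVec a₁ h₁ δ t ij.1 ij.2)‖) ∧
      ∑' q : ℤ × ℤ × ℤ, lennardJones (dist (G (barlowPos a₁ h₁ s n 0 0)) (G (barlowPos a₁ h₁ s q.1 q.2.1 q.2.2))) =
        (∑' k : ℕ, ∑' ij : ℤ × ℤ, lennardJones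
          ‖G (layerVec a₁ h₁ (haggLabel s (n + ((k : ℤ) + 1)) - haggLabel s n) ((k : ℤ) + 1) ij.1 ij.2)‖) +
        (∑' ij : ℤ × ℤ, lennardJones ‖G (layerVec a₁ h₁ 0 0 ij.1 ij.2)‖) +
        ∑' k : ℕ, ∑' ij : ℤ × ℤ, lennardJones
          ‖G (layerVec a₁ h₁ (haggLabel s (n + -((k : ℤ) + 1)) - haggLabel s n) (-((k : ℤ) + 1)) ij.1 ij.2)‖ :=
  fun _ _ s _ ha₁ hh₁ hp hs G n =>
    ⟨cbbc_summable_lennardJones_deformed ha₁ hh₁ ha₁.ne' hh₁.ne' hp hs G (G (barlowPos _ _ s n 0 0)),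
      fun δ => cbbc_summable_deformedLayer ha₁ hh₁ G δ, cbbc_tsum_deformed_eq_layers ha₁ hh₁ hp hs G n⟩

end Layers



end Summit.AtomisticToContinuum.Crystallization.Theorems.NashClassCertificatesNashNearField

end
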